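import Mathlib.RingTheory.Extension.Presentation.Core
import Mathlib.RingTheory.Smooth.StandardSmoothCotangent
import Mathlib.RingTheory.Ideal.Quotient.Nilpotent
import Mathlib.RingTheory.TensorProduct.Quotient
import HarnessLib

/-!
# Standard smooth algebras lift along surjections with nilpotent kernel
# ([Oort1971] Lemma (2.2.4) «locally `X′` can be lifted to `R`», after [SGA1] Exp. III)

Topic `Literature/AlgebraicGeometry/Deformation`; namespace `Literature.AlgebraicGeometry.Deformation.StandardSmoothLift`.  PROOF FILE
(theorems only: no definition, no instance, no notation, no named fact, no `sorry`); ring level; any commutative ring `A`.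
Cell `hodgecm-mathlib` (D-0151), FLOOR 0, P6 «MOD programme», generic organ (R1) of the census for `stub_L4B1u_abelianLiftOfIsUnitTwo`
((U) «abelian schemes lift along small extensions», line `Cruxes/HLiu418/Lines/F0_P6b_BTSerreTate.lean` §1) and for P6d's «tuples lift along
small extensions»: the LOCAL EXISTENCE of smooth lifts.  `--supports stmt-HodgeConjecture-24832`; count-neutral: HC_CM is proved only modulo
the printed citations until rung 0 closes, and nothing here bears on it.

THE PRINT.  [Oort1971] Lemma (2.2.4) (after [SGA1] Exp. III): «Let `R` be a noetherian ring, `I ⊂ R` a nilpotent ideal, and `R′ = R/I`; let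
`X′ → S′ = Spec (R′)` be a smooth scheme.  For every `x ∈ X′` there exists an open neighbourhood `x ∈ U′ ⊂ X′` and a smooth morphism
`U → S = Spec (R)` such that `U ⊗_R R′ ≅ U′` … (locally `X′` can be lifted to `R`, and the lift is unique locally up to a (non-canonical)
isomorphism).»  Since a smooth morphism is locally STANDARD SMOOTH (Mathlib `AlgebraicGeometry.Smooth.iff_forall_exists_isStandardSmooth`,
`Algebra.IsStandardSmooth`: a presentation `R′[x₁, …, x_n]/(f₁, …, f_c)` whose Jacobian minor is a unit), the existence half is the
following piece of algebra, typed here with Mathlib's presentation API (`Algebra.Presentation.HasCoeffs`, `ModelOfHasCoeffs`,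
`tensorModelOfHasCoeffsEquiv`, `PreSubmersivePresentation.ofHasCoeffs`):

* **`exists_submersivePresentation_lift`** — for ANY commutative ring `A`, a NILPOTENT ideal `J`, and a submersive presentation `P` of an
  `A ⧸ J`-algebra `B₀` (generators `ι`, relations `σ`, both finite): lifting the coefficients of the relations along `A ↠ A ⧸ J` gives an
  `A`-algebra `B` (the MODEL `A[x_ι]/(F_σ)`) with a submersive presentation on the SAME index types and `(A ⧸ J) ⊗_A B ≃ₐ[A ⧸ J] B₀`.
  The only point is the Jacobian: its image in `B₀ = B / J B` is the Jacobian of `P`, a unit, and `J B` is nilpotent, so it is a unit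
  (Mathlib `IsNilpotent.isUnit_quotient_mk_iff`, `Algebra.TensorProduct.quotIdealMapEquivQuotTensor`).
* **`exists_isStandardSmooth_lift`**, **`exists_isStandardSmoothOfRelativeDimension_lift`** — the class-level statements: a standard
  smooth `A ⧸ J`-algebra (of relative dimension `n`) lifts to a standard smooth `A`-algebra (of relative dimension `n`); the lift is in
  particular SMOOTH and of finite presentation over `A` (Mathlib instances).

NOT HERE: uniqueness of the lift up to isomorphism (formal smoothness + flatness; organ (R2)), and the scheme-level gluing.

## References
* [Oort1971] F. Oort, *Finite group schemes, local moduli for abelian varieties, and lifting problems*, Compositio Math. 23 (1971),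
  Lemma (2.2.4) (p. 274) and its proof via EGA IV₄ 17.11.4, 18.1.2.
* [SGA1] A. Grothendieck, M. Raynaud, *Revêtements étales et groupe fondamental (SGA 1)*, LNM 224 ∕ arXiv:math/0206203, Exp. III
  («Morphismes lisses: généralités, propriétés différentielles») — the source [Oort1971] (2.2.4) cites («cf. SGA, exp. III, th. 4.1»).
* [StacksProject] The Stacks Project, Tag 00T6 (Algebra, Definition 10.137.5: standard smooth algebras).
-/

noncomputable section

universe u

open TensorProduct

namespace Literature.AlgebraicGeometry.Deformation.StandardSmoothLift

variable {A : Type u} [CommRing A] {J : Ideal A}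

/-- **Submersive presentations lift along a surjection with nilpotent kernel.**  Let `J ⊆ A` be a nilpotent ideal and `P` a submersive
presentation (Mathlib `Algebra.SubmersivePresentation`: finitely many generators `ι` and relations `σ`, invertible Jacobian minor) of
an `A ⧸ J`-algebra `B₀`.  Then there is an `A`-algebra `B` with a submersive presentation on the same index types and an isomorphism
`(A ⧸ J) ⊗_A B ≃ₐ[A ⧸ J] B₀`: `B` is the model `A[x_ι]/(F_σ)` on arbitrary lifts `F_σ` of the relations (Mathlib `ModelOfHasCoeffs`,
`tensorModelOfHasCoeffsEquiv`), whose Jacobian is a unit because it is one modulo the nilpotent ideal `J·B` (its image in `B₀` is the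
Jacobian of `P`). [cite: Oort1971, Lemma (2.2.4) (p. 274)] [cite: StacksProject, Tag 00T6] -/
theorem exists_submersivePresentation_lift (hJ : IsNilpotent J) {B₀ : Type u} [CommRing B₀] [Algebra (A ⧸ J) B₀]
    {ι σ : Type} [Finite ι] [Finite σ] (P : Algebra.SubmersivePresentation (A ⧸ J) B₀ ι σ) :
    ∃ (B : Type u) (_ : CommRing B) (_ : Algebra A B),
      Nonempty (Algebra.SubmersivePresentation A B ι σ) ∧ Nonempty ((A ⧸ J) ⊗[A] B ≃ₐ[A ⧸ J] B₀) := by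
  classical
  -- `B₀` as an `A`-algebra through `A → A ⧸ J`
  letI : Algebra A B₀ := ((algebraMap (A ⧸ J) B₀).comp (Ideal.Quotient.mk J)).toAlgebra
  haveI : IsScalarTower A (A ⧸ J) B₀ := IsScalarTower.of_algebraMap_eq fun _ => rfl
  -- every polynomial over `A ⧸ J` has coefficients in the image of `A`
  haveI : P.HasCoeffs A :=
    ⟨fun x _ => by
      obtain ⟨a, ha⟩ := Ideal.Quotient.mk_surjective x
      exact ⟨a, ha⟩⟩
  let P' := P.toPreSubmersivePresentation.ofHasCoeffs A
  -- the Jacobian of the model reduces to the Jacobian of `P`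
  have hjac : P'.jacobian = Ideal.Quotient.mk _ (P.jacobianOfHasCoeffs A) := by
    letI := Classical.decEq σ
    letI := Fintype.ofFinite σ
    rw [Algebra.PreSubmersivePresentation.jacobian_eq_jacobiMatrix_det]
    rfl
  have key : P.toPresentation.tensorModelOfHasCoeffsEquiv A ((1 : A ⧸ J) ⊗ₜ P'.jacobian) = P.jacobian := by
    rw [hjac, ← Algebra.Presentation.tensorModelOfHasCoeffsEquiv_symm_tmul, AlgEquiv.apply_symm_apply,
      Algebra.SubmersivePresentation.aeval_jacobianOfHasCoeffs]
  -- `J · B` is nilpotent, so the Jacobian of the model is a unit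
  have hnil : IsNilpotent (J.map (algebraMap A (P.toPresentation.ModelOfHasCoeffs A))) := by
    obtain ⟨n, hn⟩ := hJ
    exact ⟨n, by rw [← Ideal.map_pow, hn, Ideal.zero_eq_bot, Ideal.map_bot, Ideal.zero_eq_bot]⟩
  have hunit : IsUnit P'.jacobian := by
    rw [← IsNilpotent.isUnit_quotient_mk_iff hnil]
    have h1 : IsUnit ((1 : A ⧸ J) ⊗ₜ[A] P'.jacobian) := by
      have h := P.jacobian_isUnit
      rw [← key] at h
      simpa using h.map (P.toPresentation.tensorModelOfHasCoeffsEquiv A).symm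
    have h2 := h1.map (Algebra.TensorProduct.quotIdealMapEquivQuotTensor (P.toPresentation.ModelOfHasCoeffs A) J).symm
    rwa [← Algebra.TensorProduct.quotIdealMapEquivQuotTensor_mk, AlgEquiv.symm_apply_apply] at h2
  exact ⟨P.toPresentation.ModelOfHasCoeffs A, inferInstance, inferInstance, ⟨⟨P', hunit⟩⟩,
    ⟨P.toPresentation.tensorModelOfHasCoeffsEquiv A⟩⟩

/-- **Standard smooth algebras lift along surjections with nilpotent kernel** ([Oort1971] (2.2.4) «locally `X′` can be lifted to `R`», the
affine algebra behind it): for a nilpotent ideal `J ⊆ A` and a standard smooth `A ⧸ J`-algebra `B₀` there is a standard smooth (in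
particular smooth, finitely presented, flat) `A`-algebra `B` with `(A ⧸ J) ⊗_A B ≃ₐ[A ⧸ J] B₀`.
[cite: Oort1971, Lemma (2.2.4) (p. 274)] [cite: StacksProject, Tag 00T6] -/
theorem exists_isStandardSmooth_lift (hJ : IsNilpotent J) (B₀ : Type u) [CommRing B₀] [Algebra (A ⧸ J) B₀]
    [Algebra.IsStandardSmooth (A ⧸ J) B₀] :
    ∃ (B : Type u) (_ : CommRing B) (_ : Algebra A B),
      Algebra.IsStandardSmooth A B ∧ Nonempty ((A ⧸ J) ⊗[A] B ≃ₐ[A ⧸ J] B₀) := by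
  obtain ⟨ι, σ, _, _, ⟨P⟩⟩ := (inferInstance : Algebra.IsStandardSmooth (A ⧸ J) B₀).out
  obtain ⟨B, _, _, ⟨Q⟩, e⟩ := exists_submersivePresentation_lift hJ P
  exact ⟨B, inferInstance, inferInstance, Q.isStandardSmooth, e⟩

/-- **The same with the relative dimension**: a standard smooth `A ⧸ J`-algebra of relative dimension `n` lifts, along a surjection
`A ↠ A ⧸ J` with nilpotent kernel, to a standard smooth `A`-algebra of relative dimension `n` (the lifted presentation has the same
generators and relations). [cite: Oort1971, Lemma (2.2.4) (p. 274)] [cite: StacksProject, Tag 00T6] -/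
theorem exists_isStandardSmoothOfRelativeDimension_lift (hJ : IsNilpotent J) (n : ℕ) (B₀ : Type u) [CommRing B₀]
    [Algebra (A ⧸ J) B₀] [Algebra.IsStandardSmoothOfRelativeDimension n (A ⧸ J) B₀] :
    ∃ (B : Type u) (_ : CommRing B) (_ : Algebra A B),
      Algebra.IsStandardSmoothOfRelativeDimension n A B ∧ Nonempty ((A ⧸ J) ⊗[A] B ≃ₐ[A ⧸ J] B₀) := by
  obtain ⟨ι, σ, _, _, P, hP⟩ := (inferInstance : Algebra.IsStandardSmoothOfRelativeDimension n (A ⧸ J) B₀).out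
  obtain ⟨B, _, _, ⟨Q⟩, e⟩ := exists_submersivePresentation_lift hJ P
  exact ⟨B, inferInstance, inferInstance, Q.isStandardSmoothOfRelativeDimension
    (by simpa only [Algebra.Presentation.dimension] using hP), e⟩

/-- **Smooth consequence**: the lift of a standard smooth algebra along a nilpotent surjection may be taken SMOOTH over `A` (Mathlib: standard
smooth ⇒ smooth). [cite: Oort1971, Lemma (2.2.4) (p. 274)] [cite: StacksProject, Tag 00T6] -/
theorem exists_smooth_lift (hJ : IsNilpotent J) (B₀ : Type u) [CommRing B₀] [Algebra (A ⧸ J) B₀]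
    [Algebra.IsStandardSmooth (A ⧸ J) B₀] :
    ∃ (B : Type u) (_ : CommRing B) (_ : Algebra A B),
      Algebra.Smooth A B ∧ Nonempty ((A ⧸ J) ⊗[A] B ≃ₐ[A ⧸ J] B₀) := by
  obtain ⟨B, _, _, hB, e⟩ := exists_isStandardSmooth_lift hJ B₀
  exact ⟨B, inferInstance, inferInstance, inferInstance, e⟩

end Literature.AlgebraicGeometry.Deformation.StandardSmoothLift

end
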